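/-
Part B of the (nb, neg) census row V45 «DILATION BUDGET» kernel (cell rh-split, lane (xv-X) of RULINGS #313/#315):
nb-neg g20 `NbDilationBudget.lean` sha16 244bd3f9203e1899, source ll.243–551 verbatim (the DILATION BUDGET INEQUALITY
`nb_dilation_budget`, `nb_real_menu_le_iff`, DIL(η) and its RH-bookkeeping `rh_iff_dil_and_quasiRH`, `dil_of_neg`, …); split at
the referee-named seam l.242|243 only because Theorems files with proofs are ≤ 400 lines; part A = `NbDilationBudgetA.lean`
(ll.1–242: `false_of_forall_le_mul`, `norm_mellin_le_of_nbApprox`).  Nothing here bears on the truth of RH.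
-/
import Summits.RiemannHypothesis.RiemannHypothesis.Theorems.Splittings.NbDilationBudgetA
import HarnessLib

/-!
# RH-EQUIVALENT·SPLITTING CENSUS (nb, neg) · V45 «DILATION BUDGET», part B — the budget inequality and the DIL(η) bookkeeping

See part A's module docstring for the census text, labels and barrier B25 «NB-BUDGET».  HONEST LABEL: the RH-free budget
inequality is a theorem; `rh_iff_dil_and_quasiRH` and `dil_iff_rh_of_half_le` are RH-EQUIVALENCES / relabellings;
nothing here bears on the truth of RH.
-/

set_option linter.dupNamespace false

noncomputable section

open Complex Filter MeasureTheory Set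
open scoped Real Topology

namespace Summit.RiemannHypothesis.RiemannHypothesis.Theorems.Splittings.NbDilationBudget

open Literature.NumberTheory.LFunctions
open Summit.RiemannHypothesis.RiemannHypothesis.Theorems.Splittings.NbTargets

/-- **THE DILATION BUDGET INEQUALITY (RH-free).**  Let `X ≥ 1`, let `0 < t_j ≤ X` be a finite real
menu and `c_j` real with `‖χ - ∑ c_j {t_j/x}‖_{L²(0,∞)} < ε`.  Then at every zero `ρ` of `ζ` with
`1/2 < β = Re ρ < 1`:
`‖1/ρ‖ ≤ ε · X^{β-1/2} · (‖𝟙_(0,1] x^{ρ-1}‖_{L²(0,∞)} + ‖1/(ρ-1)‖)`  (`‖𝟙_(0,1]x^{ρ-1}‖₂ =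
1/√(2β-1)`).  Proof: dilate by `X` — `∑ c_j{t_j/(Xy)}` has inverse parameters `X/t_j ≥ 1`, the
dilated target is `𝟙_(0,1/X]` with Mellin transform `X^{-s}/s` (`NbTargets.mellin_indicator_Ioc_zero`)
and the error is `ε X^{-1/2}` (`NbTargets.eLpNorm_comp_mul_left_Ioi`); apply
`norm_mellin_le_of_nbApprox`.  Read contrapositively it is the COST LAW of Nyman–Beurling
approximation: an off-line zero `ρ` forces `X ≥ (c_ρ/ε)^{1/(β-1/2)}` for every `ε`-approximant.
In print for the natural menu (`X = N`) this is the mechanism behind Báez-Duarte–Balazard–Landreau–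
Saias' lower bounds for `d_N`; the real-menu, explicit-exponent form is the census contribution.
[cite: BaezDuarte2003, Thm. 1.1; Balazard2020, Prop. 10 (i), Prop. 11] -/
theorem nb_dilation_budget {J : ℕ} {t c : Fin J → ℝ} {X ε : ℝ} (hX : 1 ≤ X)
    (ht : ∀ j, 0 < t j ∧ t j ≤ X) (hε : 0 < ε)
    (hN : eLpNorm (fun x : ℝ ↦ (Ioc (0 : ℝ) 1).indicator 1 x -
        ∑ j : Fin J, c j * Int.fract (t j / x)) 2 (volume.restrict (Ioi 0)) < ENNReal.ofReal ε)
    {s : ℂ} (hζ : riemannZeta s = 0) (hσ : 1 / 2 < s.re) (hσ1 : s.re < 1) :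
    ‖(1 : ℂ) / s‖ ≤ ε * X ^ (s.re - 1 / 2) *
      ((eLpNorm ((Ioc (0 : ℝ) 1).indicator fun x : ℝ ↦ (x : ℂ) ^ (s - 1)) 2
          (volume.restrict (Ioi 0))).toReal + ‖(1 : ℂ) / (s - 1)‖) := by
  have hX0 : 0 < X := by linarith
  have hre : 0 < s.re := by linarith
  have hs0 : s ≠ 0 := fun h' ↦ by simp [h'] at hre
  -- the difference function and the dilated target
  set D : ℝ → ℝ := fun x ↦ (Ioc (0 : ℝ) 1).indicator 1 x -
    ∑ j : Fin J, c j * Int.fract (t j / x) with hD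
  have hDm : Measurable D := by
    refine (measurable_one.indicator measurableSet_Ioc).sub (Finset.measurable_sum _ fun j _ ↦ ?_)
    exact measurable_const.mul (measurable_fract.comp (by fun_prop))
  set f : ℝ → ℝ := (Ioc (0 : ℝ) (1 / X)).indicator 1 with hf
  have hfm : Measurable f := measurable_one.indicator measurableSet_Ioc
  have hf2 : MemLp f 2 (volume.restrict (Ioi 0)) := by
    have hfin : (volume.restrict (Ioi (0 : ℝ))) (Ioc 0 (1 / X)) ≠ ⊤ := by
      rw [Measure.restrict_apply measurableSet_Ioc]
      exact ((measure_mono inter_subset_left).trans_lt measure_Ioc_lt_top).ne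
    exact memLp_indicator_const 2 measurableSet_Ioc (1 : ℝ) (Or.inr hfin)
  have hf1 : ∀ x, 1 < x → f x = 0 := by
    intro x hx
    have h1X : 1 / X ≤ 1 := (div_le_one hX0).2 hX
    exact indicator_of_notMem (fun h' : x ∈ Ioc (0 : ℝ) (1 / X) ↦
      absurd (h'.2.trans h1X) (not_le.2 hx)) _
  -- the dilated approximant: inverse parameters `X / t j ≥ 1`, error `ε X^{-1/2}`
  have hk : ∀ j, 1 ≤ X / t j := fun j ↦ (one_le_div (ht j).1).2 (ht j).2
  have hcomp : (fun y : ℝ ↦ f y - ∑ j : Fin J, c j * Int.fract (1 / (X / t j * y))) =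
      fun y ↦ D (X * y) := by
    funext y
    simp only [hf, hD, indicator_Ioc_dilate hX0 y, div_mul_eq_mul_div, one_div_div]
  have hN' : eLpNorm (fun y : ℝ ↦ f y - ∑ j : Fin J, c j * Int.fract (1 / (X / t j * y))) 2
      (volume.restrict (Ioi 0)) < ENNReal.ofReal (X⁻¹ ^ (1 / 2 : ℝ) * ε) := by
    rw [hcomp, eLpNorm_comp_mul_left_Ioi hDm hX0]
    have hc0 : ENNReal.ofReal X⁻¹ ^ (1 / 2 : ℝ) ≠ 0 := by simp [hX0]
    have hctop : ENNReal.ofReal X⁻¹ ^ (1 / 2 : ℝ) ≠ ⊤ := by simp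
    calc ENNReal.ofReal X⁻¹ ^ (1 / 2 : ℝ) * eLpNorm D 2 (volume.restrict (Ioi 0))
        < ENNReal.ofReal X⁻¹ ^ (1 / 2 : ℝ) * ENNReal.ofReal ε :=
          ENNReal.mul_lt_mul_right hc0 hctop hN
      _ = ENNReal.ofReal (X⁻¹ ^ (1 / 2 : ℝ) * ε) := by
          rw [ENNReal.ofReal_rpow_of_nonneg (inv_nonneg.2 hX0.le) (by norm_num),
            ← ENNReal.ofReal_mul (Real.rpow_nonneg (inv_nonneg.2 hX0.le) _)]
  have hε' : 0 < X⁻¹ ^ (1 / 2 : ℝ) * ε := mul_pos (Real.rpow_pos_of_pos (inv_pos.2 hX0) _) hε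
  have key := norm_mellin_le_of_nbApprox hfm hf2 hf1 hk hε' hN' hζ hσ hσ1
  rw [hf, mellin_indicator_Ioc_zero (one_div_pos.2 hX0) hre, norm_div,
    norm_cpow_eq_rpow_re_of_pos (one_div_pos.2 hX0)] at key
  set K : ℝ := (eLpNorm ((Ioc (0 : ℝ) 1).indicator fun x : ℝ ↦ (x : ℂ) ^ (s - 1)) 2
      (volume.restrict (Ioi 0))).toReal + ‖(1 : ℂ) / (s - 1)‖ with hK
  -- `key : (1/X)^β / ‖s‖ ≤ X⁻¹^{1/2} · ε · K`; multiply by `X^β`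
  have hP : 0 < X ^ s.re := Real.rpow_pos_of_pos hX0 _
  have h1 : (1 / X) ^ s.re = (X ^ s.re)⁻¹ := by rw [one_div, Real.inv_rpow hX0.le]
  have h2 : X⁻¹ ^ (1 / 2 : ℝ) = (X ^ (1 / 2 : ℝ))⁻¹ := Real.inv_rpow hX0.le _
  have h3 : X ^ (s.re - 1 / 2) = X ^ s.re / X ^ (1 / 2 : ℝ) := Real.rpow_sub hX0 _ _
  rw [h1, h2] at key
  rw [h3, norm_div, norm_one]
  calc 1 / ‖s‖ = X ^ s.re * ((X ^ s.re)⁻¹ / ‖s‖) := by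
        rw [← mul_div_assoc, mul_inv_cancel₀ hP.ne']
    _ ≤ X ^ s.re * ((X ^ (1 / 2 : ℝ))⁻¹ * ε * K) := mul_le_mul_of_nonneg_left key hP.le
    _ = ε * (X ^ s.re / X ^ (1 / 2 : ℝ)) * K := by rw [div_eq_mul_inv]; ring

/-- **BOUNDED BUDGET ⟺ RH (COSTUME).**  For every fixed `X ≥ 1`: «for every `ε > 0` there are a
finite real menu `0 < t_j ≤ X` and real `c_j` with `‖χ - ∑ c_j{t_j/x}‖_{L²(0,∞)} < ε`» is
EQUIVALENT to the Riemann hypothesis.  (⟸): Báez-Duarte's natural approximants have menu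
`t_k = 1/(k+1) ∈ (0,1]` (`Literature.NumberTheory.LFunctions.baezDuarte_iff_holds`).  (⟹): with
`X` fixed, `nb_dilation_budget` gives `‖1/ρ‖ ≤ ε·const` at an off-line zero for every `ε`; then the
functional equation (`quasiRiemannHypothesis_one_half_iff_holds`).  So bounding the dilations does
not split Báez-Duarte's criterion: every bounded-menu variant is the same RH-equivalent.
[cite: BaezDuarte2003, Thm. 1.1; Balazard2020, Prop. 10 (i)] -/
theorem nb_real_menu_le_iff {X : ℝ} (hX : 1 ≤ X) :
    (∀ ε : ℝ, 0 < ε → ∃ (J : ℕ) (t c : Fin J → ℝ), (∀ j, 0 < t j ∧ t j ≤ X) ∧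
      eLpNorm (fun x : ℝ ↦ (Ioc (0 : ℝ) 1).indicator 1 x -
        ∑ j : Fin J, c j * Int.fract (t j / x)) 2 (volume.restrict (Ioi 0)) <
          ENNReal.ofReal ε) ↔ RiemannHypothesis := by
  constructor
  · intro h
    refine quasiRiemannHypothesis_one_half_iff_holds.1 fun s hζ hσ hσ1 ↦ ?_
    have hX0 : 0 < X := by linarith
    have hre : 0 < s.re := by linarith
    have hs0 : s ≠ 0 := fun h' ↦ by simp [h'] at hre
    have hpos : 0 < ‖(1 : ℂ) / s‖ := by
      rw [norm_div, norm_one]; exact one_div_pos.2 (norm_pos_iff.2 hs0)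
    set K : ℝ := (eLpNorm ((Ioc (0 : ℝ) 1).indicator fun x : ℝ ↦ (x : ℂ) ^ (s - 1)) 2
      (volume.restrict (Ioi 0))).toReal + ‖(1 : ℂ) / (s - 1)‖ with hK
    have hK0 : 0 ≤ K := by positivity
    have hL0 : 0 < X ^ (s.re - 1 / 2) := Real.rpow_pos_of_pos hX0 _
    refine false_of_forall_le_mul hpos (mul_nonneg hL0.le hK0) fun ε hε ↦ ?_
    obtain ⟨J, t, c, ht, hN⟩ := h ε hε
    have hb := nb_dilation_budget hX ht hε hN hζ hσ hσ1
    rw [← hK] at hb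
    simpa only [mul_assoc] using hb
  · intro hRH ε hε
    obtain ⟨N, c, hN⟩ := baezDuarte_iff_holds.1 hRH ε hε
    refine ⟨N, fun k ↦ 1 / ((k : ℕ) + 1 : ℝ), c, fun k ↦ ⟨by positivity, ?_⟩, ?_⟩
    · have h1 : 1 / ((k : ℕ) + 1 : ℝ) ≤ 1 :=
        (div_le_one (by positivity)).2 (by linarith [(k : ℕ).cast_nonneg (α := ℝ)])
      exact h1.trans hX
    · simpa only [div_div] using hN

/-- **DIL(η) ⟹ a zero-free strip (RH-free).**  If for every `δ > 0` there are `X ≥ 1`, `ε > 0`,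
a finite real menu `0 < t_j ≤ X` and real `c_j` with `‖χ - ∑ c_j{t_j/x}‖_{L²(0,∞)} < ε` and
`ε·X^η < δ` (approximation at a polynomial DILATION BUDGET, exponent `η`), then `ζ` has no zero
with `1/2 < Re s ≤ 1/2 + η`:  at such a zero `nb_dilation_budget` gives
`‖1/s‖ ≤ ε X^{β-1/2} K ≤ (ε X^η) K < δ K` for every `δ`.  (For `Re s ≥ 1` Mathlib's
`riemannZeta_ne_zero_of_one_le_re`.) [cite: BaezDuarte2003, Thm. 1.1; Balazard2020, Prop. 11] -/
theorem false_of_dil {η : ℝ}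
    (hD : ∀ δ : ℝ, 0 < δ → ∃ (J : ℕ) (t c : Fin J → ℝ) (X ε : ℝ), 1 ≤ X ∧ 0 < ε ∧
      (∀ j, 0 < t j ∧ t j ≤ X) ∧
      eLpNorm (fun x : ℝ ↦ (Ioc (0 : ℝ) 1).indicator 1 x -
        ∑ j : Fin J, c j * Int.fract (t j / x)) 2 (volume.restrict (Ioi 0)) <
          ENNReal.ofReal ε ∧ ε * X ^ η < δ)
    {s : ℂ} (hζ : riemannZeta s = 0) (hσ : 1 / 2 < s.re) (hση : s.re ≤ 1 / 2 + η) : False := by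
  by_cases h1 : 1 ≤ s.re
  · exact riemannZeta_ne_zero_of_one_le_re h1 hζ
  have hσ1 : s.re < 1 := not_le.1 h1
  have hre : 0 < s.re := by linarith
  have hs0 : s ≠ 0 := fun h' ↦ by simp [h'] at hre
  have hpos : 0 < ‖(1 : ℂ) / s‖ := by
    rw [norm_div, norm_one]; exact one_div_pos.2 (norm_pos_iff.2 hs0)
  set K : ℝ := (eLpNorm ((Ioc (0 : ℝ) 1).indicator fun x : ℝ ↦ (x : ℂ) ^ (s - 1)) 2
      (volume.restrict (Ioi 0))).toReal + ‖(1 : ℂ) / (s - 1)‖ with hK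
  have hK0 : 0 ≤ K := by positivity
  refine false_of_forall_le_mul hpos hK0 fun δ hδ ↦ ?_
  obtain ⟨J, t, c, X, ε, hX, hε, ht, hN, hδX⟩ := hD δ hδ
  have hb := nb_dilation_budget hX ht hε hN hζ hσ hσ1
  rw [← hK] at hb
  have hmono : X ^ (s.re - 1 / 2) ≤ X ^ η := Real.rpow_le_rpow_of_exponent_le hX (by linarith)
  calc ‖(1 : ℂ) / s‖ ≤ ε * X ^ (s.re - 1 / 2) * K := hb
    _ ≤ ε * X ^ η * K :=
        mul_le_mul_of_nonneg_right (mul_le_mul_of_nonneg_left hmono hε.le) hK0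
    _ ≤ δ * K := mul_le_mul_of_nonneg_right hδX.le hK0

/-- **RH ⟹ DIL(η) for every `η`** (Báez-Duarte's approximants have budget `X = 1`).
[cite: BaezDuarte2003, Thm. 1.1] -/
theorem dil_of_rh (hRH : RiemannHypothesis) (η : ℝ) :
    ∀ δ : ℝ, 0 < δ → ∃ (J : ℕ) (t c : Fin J → ℝ) (X ε : ℝ), 1 ≤ X ∧ 0 < ε ∧
      (∀ j, 0 < t j ∧ t j ≤ X) ∧
      eLpNorm (fun x : ℝ ↦ (Ioc (0 : ℝ) 1).indicator 1 x -
        ∑ j : Fin J, c j * Int.fract (t j / x)) 2 (volume.restrict (Ioi 0)) <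
          ENNReal.ofReal ε ∧ ε * X ^ η < δ := by
  intro δ hδ
  obtain ⟨J, t, c, ht, hN⟩ := (nb_real_menu_le_iff le_rfl).2 hRH (δ / 2) (by positivity)
  exact ⟨J, t, c, 1, δ / 2, le_rfl, by positivity, ht, hN, by rw [Real.one_rpow]; linarith⟩

/-- **THE SPLITTING OF ROW V45: RH ⟺ DIL(η) ∧ QRH(1/2+η)** for every `η ≥ 0`, where
`QRH(σ₀) = Literature.NumberTheory.LFunctions.QuasiRiemannHypothesis σ₀` («no zero with
`σ₀ < Re s < 1`»).  Conjunct A = DIL(η) is implied by RH (`dil_of_rh`) and clears the strip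
`1/2 < Re s ≤ 1/2+η` (`false_of_dil`); conjunct B clears the rest.  For `η ≥ 1/2`, A alone is RH
(`dil_iff_rh_of_half_le`, COSTUME); for `η = 0`, A is plain density over real menus (TRUE by
Wiener's Tauberian theorem + PNT) and B = QRH(1/2) ⟺ RH (DECORATION); for `0 < η < 1/2` both
converses «A ⟹ RH», «B ⟹ RH» are open — the row is a RELABELLING of the zero-free-strip partition
`(1/2,1/2+η] ∪ (1/2+η,1)` in Nyman–Beurling clothes.  Nothing here bears on the truth of RH.
[cite: BaezDuarte2003, Thm. 1.1; Balazard2020, Prop. 10 (i), Prop. 11] -/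
theorem rh_iff_dil_and_quasiRH {η : ℝ} (hη : 0 ≤ η) :
    RiemannHypothesis ↔
      (∀ δ : ℝ, 0 < δ → ∃ (J : ℕ) (t c : Fin J → ℝ) (X ε : ℝ), 1 ≤ X ∧ 0 < ε ∧
        (∀ j, 0 < t j ∧ t j ≤ X) ∧
        eLpNorm (fun x : ℝ ↦ (Ioc (0 : ℝ) 1).indicator 1 x -
          ∑ j : Fin J, c j * Int.fract (t j / x)) 2 (volume.restrict (Ioi 0)) <
            ENNReal.ofReal ε ∧ ε * X ^ η < δ) ∧
      QuasiRiemannHypothesis (1 / 2 + η) := by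
  constructor
  · intro hRH
    exact ⟨dil_of_rh hRH η,
      (riemannHypothesis_iff_strip_holds.1 hRH).quasiRiemannHypothesis (by linarith)⟩
  · rintro ⟨hD, hQ⟩
    refine quasiRiemannHypothesis_one_half_iff_holds.1 fun s hζ hσ hσ1 ↦ ?_
    by_cases hs : s.re ≤ 1 / 2 + η
    · exact false_of_dil hD hζ hσ hs
    · exact hQ s hζ (not_le.1 hs) hσ1

/-- **COSTUME end: for `η ≥ 1/2`, DIL(η) ⟺ RH** (the strip `1/2 < Re s ≤ 1/2+η` is the whole
critical half-strip). [cite: BaezDuarte2003, Thm. 1.1] -/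
theorem dil_iff_rh_of_half_le {η : ℝ} (hη : 1 / 2 ≤ η) :
    (∀ δ : ℝ, 0 < δ → ∃ (J : ℕ) (t c : Fin J → ℝ) (X ε : ℝ), 1 ≤ X ∧ 0 < ε ∧
      (∀ j, 0 < t j ∧ t j ≤ X) ∧
      eLpNorm (fun x : ℝ ↦ (Ioc (0 : ℝ) 1).indicator 1 x -
        ∑ j : Fin J, c j * Int.fract (t j / x)) 2 (volume.restrict (Ioi 0)) <
          ENNReal.ofReal ε ∧ ε * X ^ η < δ) ↔ RiemannHypothesis :=
  ⟨fun hD ↦ quasiRiemannHypothesis_one_half_iff_holds.1 fun _ hζ hσ hσ1 ↦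
    false_of_dil hD hζ hσ (by linarith), fun hRH ↦ dil_of_rh hRH η⟩

/-- **DIL is antitone in the exponent**: DIL(η') ⟹ DIL(η) for `η ≤ η'` (`X ≥ 1`). [folklore] -/
theorem dil_anti {η η' : ℝ} (hle : η ≤ η')
    (hD : ∀ δ : ℝ, 0 < δ → ∃ (J : ℕ) (t c : Fin J → ℝ) (X ε : ℝ), 1 ≤ X ∧ 0 < ε ∧
      (∀ j, 0 < t j ∧ t j ≤ X) ∧
      eLpNorm (fun x : ℝ ↦ (Ioc (0 : ℝ) 1).indicator 1 x -
        ∑ j : Fin J, c j * Int.fract (t j / x)) 2 (volume.restrict (Ioi 0)) <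
          ENNReal.ofReal ε ∧ ε * X ^ η' < δ) :
    ∀ δ : ℝ, 0 < δ → ∃ (J : ℕ) (t c : Fin J → ℝ) (X ε : ℝ), 1 ≤ X ∧ 0 < ε ∧
      (∀ j, 0 < t j ∧ t j ≤ X) ∧
      eLpNorm (fun x : ℝ ↦ (Ioc (0 : ℝ) 1).indicator 1 x -
        ∑ j : Fin J, c j * Int.fract (t j / x)) 2 (volume.restrict (Ioi 0)) <
          ENNReal.ofReal ε ∧ ε * X ^ η < δ := by
  intro δ hδ
  obtain ⟨J, t, c, X, ε, hX, hε, ht, hN, hδX⟩ := hD δ hδ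
  refine ⟨J, t, c, X, ε, hX, hε, ht, hN, lt_of_le_of_lt ?_ hδX⟩
  exact mul_le_mul_of_nonneg_left (Real.rpow_le_rpow_of_exponent_le hX hle) hε.le

/-- **DIL(η) for `η ≥ 0` contains plain density over finite real menus** (drop the budget: `ε ≤
ε X^η < δ`).  The conclusion is the statement proved TRUE unconditionally in the cell's T47a
(Wiener's `L²` Tauberian theorem: `∫_0^∞ {1/x} x^{s-1} dx = -ζ(s)/s ≠ 0` on `Re s = 1/2`), so this
direction carries no information about RH. [folklore] -/
theorem nb_real_menus_of_dil {η : ℝ} (hη : 0 ≤ η)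
    (hD : ∀ δ : ℝ, 0 < δ → ∃ (J : ℕ) (t c : Fin J → ℝ) (X ε : ℝ), 1 ≤ X ∧ 0 < ε ∧
      (∀ j, 0 < t j ∧ t j ≤ X) ∧
      eLpNorm (fun x : ℝ ↦ (Ioc (0 : ℝ) 1).indicator 1 x -
        ∑ j : Fin J, c j * Int.fract (t j / x)) 2 (volume.restrict (Ioi 0)) <
          ENNReal.ofReal ε ∧ ε * X ^ η < δ) :
    ∀ ε : ℝ, 0 < ε → ∃ (J : ℕ) (t c : Fin J → ℝ), (∀ j, 0 < t j) ∧
      eLpNorm (fun x : ℝ ↦ (Ioc (0 : ℝ) 1).indicator 1 x -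
        ∑ j : Fin J, c j * Int.fract (t j / x)) 2 (volume.restrict (Ioi 0)) <
          ENNReal.ofReal ε := by
  intro ε hε
  obtain ⟨J, t, c, X, ε', hX, hε', ht, hN, hδX⟩ := hD ε hε
  refine ⟨J, t, c, fun j ↦ (ht j).1, hN.trans_le (ENNReal.ofReal_le_ofReal ?_)⟩
  have h1 : 1 ≤ X ^ η := Real.one_le_rpow hX hη
  have h2 : ε' ≤ ε' * X ^ η := le_mul_of_one_le_right hε'.le h1
  linarith

/-- **DECORATION end: for `η ≤ 0`, plain density over finite real menus ⟹ DIL(η)** (budget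
`X = 1 + ∑ t_j`, `X^η ≤ 1`).  With `nb_real_menus_of_dil`: DIL(0) ⟺ density over all finite real
menus, which is TRUE (the cell's T47a, Wiener + PNT); so the informative window of the family is
`0 < η < 1/2`. [folklore] -/
theorem dil_of_nonpos_of_nb_real_menus {η : ℝ} (hη : η ≤ 0)
    (h : ∀ ε : ℝ, 0 < ε → ∃ (J : ℕ) (t c : Fin J → ℝ), (∀ j, 0 < t j) ∧
      eLpNorm (fun x : ℝ ↦ (Ioc (0 : ℝ) 1).indicator 1 x -
        ∑ j : Fin J, c j * Int.fract (t j / x)) 2 (volume.restrict (Ioi 0)) <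
          ENNReal.ofReal ε) :
    ∀ δ : ℝ, 0 < δ → ∃ (J : ℕ) (t c : Fin J → ℝ) (X ε : ℝ), 1 ≤ X ∧ 0 < ε ∧
      (∀ j, 0 < t j ∧ t j ≤ X) ∧
      eLpNorm (fun x : ℝ ↦ (Ioc (0 : ℝ) 1).indicator 1 x -
        ∑ j : Fin J, c j * Int.fract (t j / x)) 2 (volume.restrict (Ioi 0)) <
          ENNReal.ofReal ε ∧ ε * X ^ η < δ := by
  intro δ hδ
  obtain ⟨J, t, c, ht, hN⟩ := h (δ / 2) (by positivity)
  have hsum : 0 ≤ ∑ j, t j := Finset.sum_nonneg fun j _ ↦ (ht j).le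
  have hX1 : (1 : ℝ) ≤ 1 + ∑ j, t j := by linarith
  refine ⟨J, t, c, 1 + ∑ j, t j, δ / 2, hX1, by positivity, fun j ↦ ⟨ht j, ?_⟩, hN, ?_⟩
  · have : t j ≤ ∑ i, t i := Finset.single_le_sum (fun i _ ↦ (ht i).le) (Finset.mem_univ j)
    linarith
  · have hle : (1 + ∑ j, t j) ^ η ≤ 1 := Real.rpow_le_one_of_one_le_of_nonpos hX1 hη
    have := mul_le_mul_of_nonneg_left hle (by positivity : (0 : ℝ) ≤ δ / 2)
    linarith

/-- **VACUOUS end: for `η < 0`, DIL(η) holds outright** — the EMPTY menu has error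
`‖χ‖_{L²(0,∞)} ≤ 1 < 2` and `2·X^η < δ` for `X` large.  (So a negative exponent asks nothing.)
[folklore] -/
theorem dil_of_neg {η : ℝ} (hη : η < 0) :
    ∀ δ : ℝ, 0 < δ → ∃ (J : ℕ) (t c : Fin J → ℝ) (X ε : ℝ), 1 ≤ X ∧ 0 < ε ∧
      (∀ j, 0 < t j ∧ t j ≤ X) ∧
      eLpNorm (fun x : ℝ ↦ (Ioc (0 : ℝ) 1).indicator 1 x -
        ∑ j : Fin J, c j * Int.fract (t j / x)) 2 (volume.restrict (Ioi 0)) <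
          ENNReal.ofReal ε ∧ ε * X ^ η < δ := by
  intro δ hδ
  -- budget `X = (1 + 4/δ)^{-1/η} ≥ 1`, so that `X^η = (1 + 4/δ)⁻¹`
  set B : ℝ := 1 + 4 / δ with hB
  have hB1 : 1 ≤ B := le_add_of_nonneg_right (by positivity)
  have hB0 : 0 < B := by linarith
  have hη0 : η ≠ 0 := hη.ne
  have hexp : 0 ≤ -1 / η := div_nonneg_of_nonpos (by norm_num) hη.le
  refine ⟨0, Fin.elim0, Fin.elim0, B ^ (-1 / η), 2, Real.one_le_rpow hB1 hexp, two_pos,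
    fun j ↦ j.elim0, ?_, ?_⟩
  · -- empty menu: the error is `‖χ‖₂ ≤ 1 < 2`
    have hχ : eLpNorm (fun x : ℝ ↦ (Ioc (0 : ℝ) 1).indicator (1 : ℝ → ℝ) x -
        ∑ j : Fin 0, Fin.elim0 j * Int.fract (Fin.elim0 j / x)) 2 (volume.restrict (Ioi 0)) =
        eLpNorm ((Ioc (0 : ℝ) 1).indicator fun _ : ℝ ↦ (1 : ℝ)) 2 (volume.restrict (Ioi 0)) := by
      congr 1
      funext x
      simp only [Finset.univ_eq_empty, Finset.sum_empty, sub_zero]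
      rfl
    rw [hχ]
    refine (eLpNorm_indicator_const_le (1 : ℝ) 2).trans_lt ?_
    have hμ : (volume.restrict (Ioi (0 : ℝ))) (Ioc 0 1) ≤ 1 := by
      rw [Measure.restrict_apply measurableSet_Ioc]
      refine (measure_mono inter_subset_left).trans ?_
      simp
    calc ‖(1 : ℝ)‖ₑ * (volume.restrict (Ioi (0 : ℝ))) (Ioc 0 1) ^ (1 / (2 : ENNReal).toReal)
        ≤ ‖(1 : ℝ)‖ₑ * 1 ^ (1 / (2 : ENNReal).toReal) := by gcongr
      _ = 1 := by simp
      _ < ENNReal.ofReal 2 := by simp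
  · have hXη : (B ^ (-1 / η)) ^ η = B⁻¹ := by
      rw [← Real.rpow_mul hB0.le, div_mul_cancel₀ (-1) hη0, Real.rpow_neg_one]
    have hlt : B⁻¹ < δ / 2 := by
      rw [inv_lt_comm₀ hB0 (by positivity), inv_div, hB]
      have h2 : (0 : ℝ) < 2 / δ := by positivity
      have h4 : (4 : ℝ) / δ = 2 * (2 / δ) := by ring
      linarith
    rw [hXη]
    linarith

end Summit.RiemannHypothesis.RiemannHypothesis.Theorems.Splittings.NbDilationBudget

end
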